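import Summits.PneNP.PneNP.Theorems.MonotoneContinuation.Negative.LocalStability
import Summits.PneNP.PneNP.Theorems.MonotoneContinuation.Negative.StarParity
import Summits.PneNP.PneNP.Theorems.SliceTarget.Negative.GeneralCircuits
import Literature.Computability.Complexity.LupanovBound

/-!
# `MonotoneContinuation` (stmt-PneNP-18471, route PneNP/OneSlice) — negative-side lemmas II-C: the closeness hypothesis is
# load-bearing, and not automatic

The crux `Summit.PneNP.PneNP.Theses.OneSlice.MonotoneContinuation` (MC) asks: for a small `{∧₂,∨₂}`-circuit `C`, IF its
slice-`j` transport `T_j 𝟙[C]` is `ε`-close in `L¹(G(n,p_c))` to SOME monotone Boolean function, THEN it is `η`-close to a small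
`{∧₂,∨₂}`-circuit. Assembling parts A (`LocalStability.lean`) and B (`StarParity.lean`):

* `eventually_starParity_witness` — at `k = 3` (`p_c = 1/n`, `pc_three`), eventually and for EVERY central `j`: Berkowitz's
  monotonization (`sliceMonotonization_proof`) of the `n`-gate XOR chain of the star of vertex `0` (`exists_B2_parityOn`) is a
  `{∧₂,∨₂}`-circuit with `≤ n^{c₀+2}` gates whose slice-`j` transport is `≥ 1/10`-far from EVERY monotone Boolean function
  (`1/8` from part B minus the transport error `≤ 1/40` of part A, `eventually_parity_stability`).
* `monotoneContinuation_false_without_closeness` — MC with the hypothesis "`T_j 𝟙[C]` is `ε`-close to a monotone Boolean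
  function" DROPPED (everything else verbatim, in the read-back vocabulary `l1`/`transport`/`pc`/`Central` of `rdist_eq_l1`)
  is FALSE (`k = 3`, `η = 1/20`, every `c'`).
* `not_transportNearMonotone` — the natural strengthening "the hypothesis always holds" is FALSE.

So any proof of MC must USE the near-monotonicity of the transport, and no argument that treats `C` merely as a small monotone
circuit can succeed: on a slice `C` may carry an arbitrary small-circuit function (Berkowitz) whose transport is a near-Boolean
NON-monotone profile. Work file with the running commentary (why MC resists an unconditional kill — it would be a
superpolynomial average-case monotone-vs-general separation at one critical product measure):
`Summits/PneNP/PneNP/Cruxes/MonotoneContinuation/Disproof.lean`. Refuter seat refuter-cdisprove-stmt-PneNP-18471-0, 2026-08-17.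
-/

set_option linter.dupNamespace false

namespace Summit.PneNP.PneNP.Theorems.MonotoneContinuation.Negative

open Literature.Computability.Complexity hiding supp mem_supp
open Finset hiding slice
open Filter hiding mem_sdiff
open Classical
open Summit.PneNP.PneNP.Theorems.ConstantBand.Negative (Edge thr Central central_thr slice)
open Summit.PneNP.PneNP.Theorems.SliceACZero.Negative (supp mem_supp card_supp supp_injective supp_indicator
  card_slice_supset_le)
open Summit.PneNP.PneNP.Theorems.SingleThreshold.Negative (pc pc_nonneg pc_le_one)
open Summit.PneNP.PneNP.Theorems.SliceTargetSplit (Comp nbhd mem_nbhd transport ind l1 nbhdCard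
  ind_nonneg ind_le_one l1_triangle l1_eq_sum_slices card_nbhd choose_mul_nbhdCard nbhdCard_pos
  supp_subset_of_comp_of_le abs_transport_ind_sub_ind_le_one sliceSum_abs_transport_ind_sub_ind_le
  sum_card_filter_nbhd_comm choose_pred_mul_le comp_comm card_nbhd_filter_false_le)
open Summit.PneNP.PneNP.Theorems (binomialWeight_sum_range binomialWeight_nonneg binomialWeight_tail_le card_slice
  eventually_window tendsto_mean central_add_le)

open Summit.PneNP.PneNP.Theorems.SliceTarget.Negative (eventually_central_pos_lt eventually_monotonization_small)

noncomputable section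

variable {n : ℕ}

/-- `parityOn T` is `T`-local. [folklore] -/
theorem parityOn_local (T : Finset (Edge n)) : LocalOn T (parityOn T) := by
  intro x y hxy
  unfold parityOn
  have : T ∩ supp x = T ∩ supp y := by
    ext e
    simp only [mem_inter, mem_supp]
    constructor
    · rintro ⟨he, hx⟩; exact ⟨he, by rwa [← hxy e he]⟩
    · rintro ⟨he, hy⟩; exact ⟨he, by rwa [hxy e he]⟩
  rw [this]

/-! ### Part C. Circuits and assembly -/

/-- The XOR chain computes the parity of the number of ones. [folklore] -/
theorem parityFin_eq_decide_odd : ∀ (M : ℕ) (z : Fin M → Bool),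
    parityFin M z = decide (Odd #(univ.filter fun i : Fin M => z i = true))
  | 0, z => by simp [parityFin]
  | M + 1, z => by
    rw [parityFin, parityFin_eq_decide_odd M]
    have hc : #(univ.filter fun i : Fin (M + 1) => z i = true)
        = #(univ.filter fun i : Fin M => z i.castSucc = true) + (if z (Fin.last M) = true then 1 else 0) := by
      rw [card_filter, card_filter, Fin.sum_univ_castSucc]
    rw [hc]
    cases z (Fin.last M) <;> simp [← Nat.not_even_iff_odd, Nat.even_add_one]

/-- **A `B₂`-circuit for the parity of a set of edge variables**: `#T + 1` gates (an XOR chain). [folklore] -/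
theorem exists_B2_parityOn (T : Finset (Edge n)) :
    ∃ D : Circuit (Edge n), D.IsOver B2 ∧ D.size ≤ #T + 1 ∧ ∀ x, D.eval x = parityOn T x := by
  set e := T.equivFin with he
  have h := (cktSize_parityFin #T).rewire (ι' := Edge n) (fun i => ((e.symm i : T) : Edge n))
  obtain ⟨D, hDB, hDs, hDe⟩ := h.toCircuit
  refine ⟨D, hDB, hDs, fun x => ?_⟩
  rw [hDe x, parityFin_eq_decide_odd, parityOn]
  congr 2
  -- both count the on-edges of `x` inside `T`
  rw [← card_image_of_injective _ (f := fun i : Fin #T => ((e.symm i : T) : Edge n))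
    (Subtype.val_injective.comp e.symm.injective)]
  congr 1
  ext a
  simp only [mem_image, mem_filter, mem_univ, true_and, mem_inter, mem_supp]
  constructor
  · rintro ⟨i, hi, rfl⟩
    exact ⟨(e.symm i).2, hi⟩
  · rintro ⟨haT, hxa⟩
    refine ⟨e ⟨a, haT⟩, ?_, ?_⟩
    · simpa [Equiv.symm_apply_apply] using hxa
    · simp [Equiv.symm_apply_apply]

/-- `p_c(3) = 1/n`. [folklore] -/
theorem pc_three (n : ℕ) : pc n 3 = (n : ℝ)⁻¹ := by
  rw [pc, show (-(2 : ℝ) / ((3 : ℕ) - 1)) = -1 by norm_num, Real.rpow_neg_one]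

/-- **Eventually, the transport moves the star parity by at most `τ`** in `L¹(G(n,1/n))`, uniformly over vertices and
central slices (`k = 3`; part A with `W = 2m^{3/4}`, `t = m^{3/4}/2`: `#T·W/C(n,2) = 4m^{3/4}/n ≤ 2m^{-1/4}` and Chebyshev
`≤ 8m^{-1/2}`). [folklore] -/
theorem eventually_parity_stability {τ : ℝ} (hτ : 0 < τ) :
    ∀ᶠ n : ℕ in atTop, ∀ v : Fin n, ∀ j : ℕ, Central 3 n j →
      l1 n (pc n 3) (transport j (ind (parityOn (star v)))) (ind (parityOn (star v))) ≤ τ := by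
  have hk : (3 : ℕ) ≤ 3 := le_rfl
  have hm : Tendsto (fun n : ℕ => (thr 3 n : ℝ)) atTop atTop :=
    tendsto_natCast_atTop_atTop.comp (tendsto_nat_floor_atTop.comp (tendsto_mean hk))
  have hA : Tendsto (fun n : ℕ => (thr 3 n : ℝ) ^ ((1 : ℝ) / 4)) atTop atTop :=
    (tendsto_rpow_atTop (by norm_num)).comp hm
  filter_upwards [eventually_window hk 0, hA.eventually_ge_atTop (max 2 (10 / τ)), eventually_ge_atTop 2]
    with n hwin hAge hn2 v j hj
  obtain ⟨hp0, hp8, h34, -, hwin5⟩ := hwin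
  have hp1 : pc n 3 ≤ 1 := by linarith
  have hjN : j ≤ n.choose 2 := by simpa using central_add_le (w := 0) hp0 hp8 hwin5 hj
  have hNpos : 1 ≤ n.choose 2 := Nat.choose_pos hn2
  set m : ℝ := (thr 3 n : ℝ) with hmdef
  set A : ℝ := m ^ ((1 : ℝ) / 4) with hAdef
  set R : ℝ := m ^ ((3 : ℝ) / 4) with hRdef
  have hm0 : 0 ≤ m := Nat.cast_nonneg _
  have hA2 : 2 ≤ A := le_trans (le_max_left _ _) hAge
  have hAτ : 10 / τ ≤ A := le_trans (le_max_right _ _) hAge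
  have hA0 : 0 < A := by linarith
  have hA1 : 1 ≤ A := by linarith
  have hmA : m = A ^ 4 := by
    rw [hAdef, ← Real.rpow_natCast, ← Real.rpow_mul hm0]; norm_num
  have hRA : R = A ^ 3 := by
    rw [hRdef, hAdef, ← Real.rpow_natCast, ← Real.rpow_mul hm0]; norm_num
  have hR2 : 2 ≤ R := h34
  have hR0 : 0 < R := by linarith
  have hmpos : 0 < m := by rw [hmA]; positivity
  have hjc := abs_le.1 hj
  have hμ0 : 0 ≤ ((n.choose 2 : ℕ) : ℝ) * pc n 3 := mul_nonneg (Nat.cast_nonneg _) hp0.le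
  have hmμ : m ≤ ((n.choose 2 : ℕ) : ℝ) * pc n 3 := Nat.floor_le hμ0
  have hμm : ((n.choose 2 : ℕ) : ℝ) * pc n 3 < m + 1 := Nat.lt_floor_add_one _
  have hmain := l1_transport_local_le (parityOn_local (star v)) hp0.le hp1 hjN
    (fun i : ℕ => |(i : ℝ) - m| ≤ R) (by linarith : (0 : ℝ) ≤ 2 * R) (half_pos hR0)
    (fun i hi => by
      calc |(i : ℝ) - j| ≤ |(i : ℝ) - m| + |(m : ℝ) - j| := abs_sub_le _ _ _
        _ ≤ R + R := add_le_add hi (by rw [abs_sub_comm]; exact hj)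
        _ = 2 * R := by ring)
    (fun i _ hi => by
      push Not at hi
      have h1 : |(i : ℝ) - m| ≤ |(i : ℝ) - (n.choose 2 : ℕ) * pc n 3| + |((n.choose 2 : ℕ) : ℝ) * pc n 3 - m| :=
        abs_sub_le _ _ _
      have h2 : |((n.choose 2 : ℕ) : ℝ) * pc n 3 - m| < 1 := by
        rw [abs_lt]; constructor <;> linarith
      linarith)
  refine hmain.trans ?_
  -- numerics
  have hn2' : (2 : ℝ) ≤ n := by exact_mod_cast hn2
  have hn0 : (0 : ℝ) < n := by linarith
  have hn1 : (n : ℝ) - 1 ≠ 0 := by linarith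
  have hT : (#(star v) : ℝ) = n - 1 := by rw [card_star, Nat.cast_sub (by omega), Nat.cast_one]
  have hN : ((n.choose 2 : ℕ) : ℝ) = n * (n - 1) / 2 := Nat.cast_choose_two (K := ℝ) n
  have hpc : pc n 3 = (n : ℝ)⁻¹ := pc_three n
  -- `2m ≤ n - 1`
  have h2m : 2 * m ≤ (n : ℝ) - 1 := by
    have h1 : ((n.choose 2 : ℕ) : ℝ) * pc n 3 = ((n : ℝ) - 1) / 2 := by
      rw [hN, hpc, div_mul_eq_mul_div, mul_assoc, mul_comm ((n : ℝ) - 1), ← mul_assoc, mul_inv_cancel₀ hn0.ne',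
        one_mul]
    rw [h1] at hmμ
    linarith
  have hRA' : R * A = m := by rw [hRA, hmA]; ring
  have hterm1 : (#(star v) : ℝ) * (2 * R) / ((n.choose 2 : ℕ) : ℝ) ≤ 2 / A := by
    rw [hT, hN]
    have hden : (0 : ℝ) < n * (n - 1) / 2 := by
      have : (0 : ℝ) < (n : ℝ) - 1 := by linarith
      positivity
    rw [div_le_div_iff₀ hden hA0]
    calc ((n : ℝ) - 1) * (2 * R) * A = ((n : ℝ) - 1) * (2 * (R * A)) := by ring
      _ = ((n : ℝ) - 1) * (2 * m) := by rw [hRA']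
      _ ≤ ((n : ℝ) - 1) * ((n : ℝ) - 1) := mul_le_mul_of_nonneg_left h2m (by linarith)
      _ ≤ ((n : ℝ) - 1) * n := mul_le_mul_of_nonneg_left (by linarith) (by linarith)
      _ = 2 * ((n : ℝ) * (n - 1) / 2) := by ring
  have hNp : ((n.choose 2 : ℕ) : ℝ) * pc n 3 * (1 - pc n 3) ≤ m + 1 := by
    have : ((n.choose 2 : ℕ) : ℝ) * pc n 3 * (1 - pc n 3) ≤ ((n.choose 2 : ℕ) : ℝ) * pc n 3 :=
      mul_le_of_le_one_right hμ0 (by linarith)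
    linarith
  have hterm2 : ((n.choose 2 : ℕ) : ℝ) * pc n 3 * (1 - pc n 3) / (R / 2) ^ 2 ≤ 8 / A := by
    have hR2pos : 0 < (R / 2) ^ 2 := by positivity
    rw [div_le_div_iff₀ hR2pos hA0]
    have hstep : (m + 1) * A ≤ 8 * (R / 2) ^ 2 := by
      rw [hRA, hmA]
      exact numerics_aux hA1
    calc ((n.choose 2 : ℕ) : ℝ) * pc n 3 * (1 - pc n 3) * A ≤ (m + 1) * A :=
          mul_le_mul_of_nonneg_right hNp hA0.le
      _ ≤ 8 * (R / 2) ^ 2 := hstep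
  have hsum : 2 / A + 8 / A ≤ τ := by
    rw [← add_div, div_le_iff₀ hA0]
    rw [div_le_iff₀ hτ] at hAτ
    linarith
  linarith [hterm1, hterm2, hsum]

/-- **The witness, eventually** (`k = 3`): for all large `n` and EVERY central `j` there is a `{∧₂,∨₂}`-circuit `C` with
`≤ n^{c_w}` gates (`c_w = c₀ + 2`, `c₀` the Berkowitz constant of `sliceMonotonization_proof`, applied to the `n`-gate XOR
chain of the star of vertex `0`) whose slice-`j` transport is `≥ 1/10`-far in `L¹(G(n,1/n))` from EVERY monotone Boolean
function (`1/8` from part B minus the transport error `≤ 1/40` of part A). [folklore] -/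
theorem eventually_starParity_witness :
    ∃ cw : ℕ, ∀ᶠ n : ℕ in atTop, ∀ j : ℕ, Central 3 n j → ∃ C : Circuit (Edge n), C.IsOver monotoneBasis ∧
      C.size ≤ n ^ cw ∧ ∀ F : (Edge n → Bool) → Bool, Monotone F →
        (1 / 10 : ℝ) ≤ l1 n (pc n 3) (ind F) (transport j (ind C.eval)) := by
  obtain ⟨c₀, hc₀⟩ := Summit.PneNP.PneNP.Theorems.sliceMonotonization_proof
  refine ⟨1 + c₀ + 1, ?_⟩
  filter_upwards [eventually_central_pos_lt (k := 3) le_rfl, eventually_monotonization_small 1 c₀,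
    eventually_ge_atTop 8, eventually_parity_stability (show (0 : ℝ) < 1 / 40 by norm_num)]
    with n hcen hsm hn8 hstab j hj
  obtain ⟨hj0, hjN⟩ := hcen j hj
  set v : Fin n := ⟨0, by omega⟩ with hv
  obtain ⟨D, hDB, hDs, hDe⟩ := exists_B2_parityOn (star v)
  obtain ⟨C, hCB, hCs, hCe⟩ := hc₀ n j D hDB hj0 hjN
  have hsize : C.size ≤ n ^ (1 + c₀ + 1) := by
    have hD1 : D.size ≤ n ^ 1 := by
      rw [pow_one]
      rw [card_star] at hDs
      omega
    have : C.size ≤ c₀ * (n ^ 1 + n ^ c₀) := hCs.trans (Nat.mul_le_mul_left _ (Nat.add_le_add_right hD1 _))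
    omega
  have htr : transport j (ind C.eval) = transport j (ind (parityOn (star v))) := by
    funext y
    unfold transport
    rw [sum_congr rfl fun x hx => show ind C.eval x = ind (parityOn (star v)) x by
      simp only [ind, hCe x (mem_nbhd.1 hx).1, hDe x]]
  refine ⟨C, hCB, hsize, fun F hF => ?_⟩
  rw [htr]
  have hp0 : 0 ≤ pc n 3 := pc_nonneg n 3
  have hp1 : pc n 3 ≤ 1 := pc_le_one (by omega) (by norm_num)
  have hfar : (1 / 8 : ℝ) ≤ l1 n (pc n 3) (ind F) (ind (parityOn (star v))) := by
    rw [pc_three]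
    exact l1_monotone_parity_ge hn8 v F hF
  have hst := hstab v j hj
  have htri := l1_triangle hp0 hp1 (ind F) (transport j (ind (parityOn (star v)))) (ind (parityOn (star v)))
  linarith

/-! ### Headlines: the closeness hypothesis is load-bearing, and not automatic -/

/-- **The closeness hypothesis is load-bearing**: MC with the hypothesis "`T_j 𝟙[C]` is `ε`-close to some monotone Boolean
function" DROPPED (everything else verbatim, read back through `rdist_eq_l1`; `MonotoneContinuationNoHyp` in the work file) is
FALSE — star-parity witness, `k = 3`, `η = 1/20`: the `η`-close `C'` would compute a monotone function
(`Circuit.monotone_eval_of_isOver_monotoneBasis`), but every monotone function is `≥ 1/10`-far from the witness's transport. [folklore] -/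
theorem monotoneContinuation_false_without_closeness :
    ¬ ∀ c : ℕ, ∃ c' : ℕ, ∀ k : ℕ, 3 ≤ k → ∀ η : ℝ, 0 < η → ∀ᶠ n : ℕ in atTop, ∀ j : ℕ, Central k n j →
      ∀ C : Circuit (Edge n), C.IsOver monotoneBasis → C.size ≤ n ^ c →
        ∃ C' : Circuit (Edge n), C'.IsOver monotoneBasis ∧ C'.size ≤ n ^ c' ∧
          l1 n (pc n k) (ind C'.eval) (transport j (ind C.eval)) ≤ η := by
  intro h
  obtain ⟨cw, hw⟩ := eventually_starParity_witness
  obtain ⟨c', hc'⟩ := h cw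
  have H := hc' 3 le_rfl (1 / 20) (by norm_num)
  obtain ⟨n, hn, hwn⟩ := (H.and hw).exists
  obtain ⟨C, hC, hCs, hfar⟩ := hwn (thr 3 n) (central_thr 3 n)
  obtain ⟨C', hC', -, hd'⟩ := hn (thr 3 n) (central_thr 3 n) C hC hCs
  have := hfar C'.eval (Circuit.monotone_eval_of_isOver_monotoneBasis C' hC')
  linarith

/-- **The natural strengthening is false**: it is NOT the case that the slice transport of every small `{∧₂,∨₂}`-circuit is
eventually `ε`-close to some monotone Boolean function (`TransportNearMonotone` in the work file; same witness, `ε = 1/20`).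
So MC cannot be proved by discharging its hypothesis, and the hypothesis is a genuine restriction on `C`. [folklore] -/
theorem not_transportNearMonotone :
    ¬ ∀ c k : ℕ, 3 ≤ k → ∀ ε : ℝ, 0 < ε → ∀ᶠ n : ℕ in atTop, ∀ j : ℕ, Central k n j →
      ∀ C : Circuit (Edge n), C.IsOver monotoneBasis → C.size ≤ n ^ c →
        ∃ F : (Edge n → Bool) → Bool, Monotone F ∧ l1 n (pc n k) (ind F) (transport j (ind C.eval)) ≤ ε := by
  intro h
  obtain ⟨cw, hw⟩ := eventually_starParity_witness
  have H := h cw 3 le_rfl (1 / 20) (by norm_num)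
  obtain ⟨n, hn, hwn⟩ := (H.and hw).exists
  obtain ⟨C, hC, hCs, hfar⟩ := hwn (thr 3 n) (central_thr 3 n)
  obtain ⟨F, hF, hd⟩ := hn (thr 3 n) (central_thr 3 n) C hC hCs
  have := hfar F hF
  linarith

end

end Summit.PneNP.PneNP.Theorems.MonotoneContinuation.Negative
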